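import Literature.Analysis.Complex.PerronHigherOrder
import Mathlib.Analysis.Real.Pi.Bounds
import HarnessLib

/-!
# Cauchy's integral formula for derivatives on a rectangle, and Cauchy's estimate from a square

Topic `Literature/Analysis/Complex`. Everything here is PROVED (theorems only). In the four-term
convention `rectBoundaryIntegral` of `ArgumentPrincipleRectangle.lean`
(`∮ = ∫_bottom − ∫_top + i∫_right − i∫_left`), for `f` complex differentiable on an open set `U`
containing the closed rectangle `R = [a,b] × [c,d]` and `ρ` an interior point of `R`:

* `rectBoundaryIntegral_div_pow_succ_eq` — **`∮_{∂R} f(z) (z − ρ)^{−(n+1)} dz = 2πi a_n`**, where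
  `a_n = ((swap dslope ρ)^[n] f) ρ` is the value at `ρ` of the `n`-th iterated divided difference
  of `f` (Mathlib's `dslope`; the form in which `HasFPowerSeriesAt.has_fpower_series_iterate_dslope_fslope`
  identifies Taylor coefficients);
* `iterate_dslope_apply_eq_iteratedDeriv_div` — `a_n = f^{(n)}(ρ)/n!`, and hence
  `rectBoundaryIntegral_div_pow_succ_eq_iteratedDeriv` —
  **`∮_{∂R} f(z) (z − ρ)^{−(n+1)} dz = 2πi f^{(n)}(ρ)/n!`** (Ahlfors, *Complex Analysis*, 3rd ed.,
  Ch. 4 §2.3 (24), for rectangles);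
* `norm_iterate_dslope_apply_le` — **Cauchy's estimate** from the square of half-side `η` centred at
  `ρ`: if `‖f‖ ≤ M` at the points of the closed square at distance `≥ η` from `ρ` (in particular on
  its boundary), then `‖a_n‖ ≤ 2M/η^n` (`8ηM/η^{n+1}` for the four edges, divided by `2π > 4`);
* tools: `rectBoundaryIntegral_sub_zpow_eq_zero` (`∮ (z−ρ)^k dz = 0`, `k ≠ −1`, generalising the
  tree's `rectBoundaryIntegral_zpow_eq_zero` from `ρ = 0`), `differentiableOn_iterate_dslope`,
  `eq_add_sub_mul_dslope` (`f(z) = f(ρ) + (z−ρ)·(dslope f ρ)(z)`), `reProdIm_mem_nhds`,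
  `mem_reProdIm_of_edge`.

The proof of the main formula is by induction on `n`: `f(z) = f(ρ) + (z−ρ) (dslope f ρ)(z)` splits
`f(z)/(z−ρ)^{n+2}` into `f(ρ)(z−ρ)^{−n−2}` (integral `0`) and `(dslope f ρ)(z)/(z−ρ)^{n+1}`, with
`dslope f ρ` again complex differentiable on `U` (`Complex.differentiableOn_dslope`); the case
`n = 0` is the tree's Cauchy integral formula for a rectangle (`integral_boundary_rect_div_sub_eq`,
`RectangleCauchyFormula.lean`). This is the residue calculus for poles of higher order on
rectangular contours (as needed, e.g., for Goldston–Pintz–Yıldırım's Lemma 3, where the integrand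
`D(s₁,s₂)R^{s₁+s₂} s₁^{−u−1} s₂^{−v−1} (s₁+s₂)^{−d}` has poles of order `u+1`, `v+1+d`, `d`).

## References

* L. V. Ahlfors, *Complex Analysis*, 3rd ed., McGraw–Hill 1979, Ch. 4 §2.3, eq. (24) and
  Cauchy's estimate p. 122. [folklore]
* D. A. Goldston, J. Pintz, C. Y. Yıldırım, *Primes in tuples. I*, Ann. of Math. 170 (2009),
  §8 (8.8), (8.15)–(8.16) (use of Leibniz residues and Cauchy's estimate).
  [cite: GoldstonPintzYildirim2009]
-/

noncomputable section

open Complex Set Function Filter Topology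

namespace Literature.Analysis.Complex

variable {a b c d : ℝ}

/-- Boundary points of `[a,b] × [c,d]` differ from an interior point `ρ`. [folklore] -/
theorem ne_of_im_ne' {z ρ : ℂ} (h : z.im ≠ ρ.im) : z ≠ ρ := fun e => h (by rw [e])

/-- idem for the real part. [folklore] -/
theorem ne_of_re_ne' {z ρ : ℂ} (h : z.re ≠ ρ.re) : z ≠ ρ := fun e => h (by rw [e])

/-- `∮_{∂R} (z − ρ)^k dz = 0` for an integer `k ≠ −1` and `ρ` in the open rectangle: `(z−ρ)^k` is
the derivative of `(z−ρ)^{k+1}/(k+1)`, analytic at every boundary point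
(`rectBoundaryIntegral_deriv_eq_zero`). [folklore] -/
theorem rectBoundaryIntegral_sub_zpow_eq_zero (ρ : ℂ) {k : ℤ} (hk : k + 1 ≠ 0) (ha : a < ρ.re)
    (hb : ρ.re < b) (hc : c < ρ.im) (hd : ρ.im < d) :
    rectBoundaryIntegral (fun s => (s - ρ) ^ k) a b c d = 0 := by
  have hab : a ≤ b := (ha.trans hb).le
  have hcd : c ≤ d := (hc.trans hd).le
  have hk' : ((k + 1 : ℤ) : ℂ) ≠ 0 := by exact_mod_cast hk
  set h : ℂ → ℂ := fun z => ((k + 1 : ℤ) : ℂ)⁻¹ * (z - ρ) ^ (k + 1) with hhdef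
  have hderiv : ∀ z : ℂ, z ≠ ρ → deriv h z = (z - ρ) ^ k := by
    intro z hz
    have hz' : z - ρ ≠ 0 := sub_ne_zero.2 hz
    have h1 : HasDerivAt (fun x : ℂ => (x - ρ) ^ (k + 1))
        (((k + 1 : ℤ) : ℂ) * (z - ρ) ^ (k + 1 - 1)) z :=
      HasDerivAt.comp_sub_const (f := fun x : ℂ => x ^ (k + 1)) z ρ
        (hasDerivAt_zpow (k + 1) (z - ρ) (Or.inl hz'))
    rw [hhdef, (h1.const_mul _).deriv]
    simp only [add_sub_cancel_right]
    field_simp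
  have han : ∀ z : ℂ, z ≠ ρ → AnalyticAt ℂ h z := fun z hz =>
    analyticAt_const.mul ((analyticAt_id.sub analyticAt_const).zpow (by
      simpa [sub_eq_zero] using hz))
  have hbot0 : ∀ x : ℝ, ((x : ℂ) + c * I) ≠ ρ := fun x => ne_of_im_ne' (by simp; exact hc.ne)
  have htop0 : ∀ x : ℝ, ((x : ℂ) + d * I) ≠ ρ := fun x => ne_of_im_ne' (by simp; exact hd.ne')
  have hleft0 : ∀ y : ℝ, ((a : ℂ) + y * I) ≠ ρ := fun y => ne_of_re_ne' (by simp; exact ha.ne)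
  have hright0 : ∀ y : ℝ, ((b : ℂ) + y * I) ≠ ρ := fun y => ne_of_re_ne' (by simp; exact hb.ne')
  rw [rectBoundaryIntegral_congr (G := deriv h) hab hcd (fun x _ => (hderiv _ (hbot0 x)).symm)
    (fun x _ => (hderiv _ (htop0 x)).symm) (fun y _ => (hderiv _ (hleft0 y)).symm)
    (fun y _ => (hderiv _ (hright0 y)).symm)]
  exact rectBoundaryIntegral_deriv_eq_zero hab hcd (fun x _ => han _ (hbot0 x))
    (fun x _ => han _ (htop0 x)) (fun y _ => han _ (hleft0 y)) (fun y _ => han _ (hright0 y))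

/-- The iterated divided differences `(swap dslope ρ)^[n] f` of a function complex differentiable
on a neighbourhood `K` of `ρ` are complex differentiable on `K`
(`Complex.differentiableOn_dslope`). [folklore] -/
theorem differentiableOn_iterate_dslope {f : ℂ → ℂ} {K : Set ℂ} {ρ : ℂ} (hK : K ∈ 𝓝 ρ)
    (hf : DifferentiableOn ℂ f K) (n : ℕ) :
    DifferentiableOn ℂ ((swap dslope ρ)^[n] f) K := by
  induction n with
  | zero => exact hf
  | succ n ih =>
    rw [Function.iterate_succ', Function.comp_apply]
    exact (Complex.differentiableOn_dslope hK).2 ih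

/-- `g z = g ρ + (z − ρ) · dslope g ρ z`. [folklore] -/
theorem eq_add_sub_mul_dslope (g : ℂ → ℂ) (ρ z : ℂ) : g z = g ρ + (z - ρ) * dslope g ρ z := by
  have := sub_smul_dslope g ρ z
  rw [smul_eq_mul] at this
  linear_combination -this

/-- The closed rectangle is a neighbourhood of its interior points. [folklore] -/
theorem reProdIm_mem_nhds {ρ : ℂ} (ha : a < ρ.re) (hb : ρ.re < b) (hc : c < ρ.im) (hd : ρ.im < d) :
    (Icc a b ×ℂ Icc c d) ∈ 𝓝 ρ :=
  mem_of_superset ((isOpen_Ioo.reProdIm isOpen_Ioo).mem_nhds ⟨⟨ha, hb⟩, ⟨hc, hd⟩⟩)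
    (reProdIm_subset_iff.2 (by
      rintro z ⟨hz1, hz2⟩
      exact ⟨Ioo_subset_Icc_self hz1, Ioo_subset_Icc_self hz2⟩))

/-- Points of the four edges belong to the closed rectangle. [folklore] -/
theorem mem_reProdIm_of_edge (hab : a ≤ b) (hcd : c ≤ d) :
    (∀ x ∈ Icc a b, ((x : ℂ) + c * I) ∈ Icc a b ×ℂ Icc c d) ∧
    (∀ x ∈ Icc a b, ((x : ℂ) + d * I) ∈ Icc a b ×ℂ Icc c d) ∧
    (∀ y ∈ Icc c d, ((a : ℂ) + y * I) ∈ Icc a b ×ℂ Icc c d) ∧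
    (∀ y ∈ Icc c d, ((b : ℂ) + y * I) ∈ Icc a b ×ℂ Icc c d) := by
  exact ⟨fun x hx => ⟨by simpa using hx, by simpa using hcd⟩,
    fun x hx => ⟨by simpa using hx, by simpa using hcd⟩,
    fun y hy => ⟨by simpa using hab, by simpa using hy⟩,
    fun y hy => ⟨by simpa using hab, by simpa using hy⟩⟩

/-- **Cauchy's integral formula for derivatives on a rectangle.** For `f` complex differentiable
on an open set `U` containing the closed rectangle `[a,b] × [c,d]` and `ρ` an interior point of the
rectangle, in the four-term convention, `∮_{∂R} f(z)/(z − ρ)^{n+1} dz = 2πi a_n`, where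
`a_n = ((swap dslope ρ)^[n] f) ρ` is the `n`-th Taylor coefficient of `f` at `ρ` (the value at `ρ`
of the `n`-th iterated divided difference; `= f^{(n)}(ρ)/n!`). Proof by induction on `n`:
`f(z) = f(ρ) + (z−ρ) (dslope f ρ)(z)`, `∮ (z−ρ)^{−n−2} dz = 0`, and the case `n = 0` is the tree's
`integral_boundary_rect_div_sub_eq`. [folklore] -/
theorem rectBoundaryIntegral_div_pow_succ_eq {f : ℂ → ℂ} {U : Set ℂ} (hU : IsOpen U) (ρ : ℂ)
    (n : ℕ) (ha : a < ρ.re) (hb : ρ.re < b) (hc : c < ρ.im) (hd : ρ.im < d)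
    (hKU : Icc a b ×ℂ Icc c d ⊆ U) (hf : DifferentiableOn ℂ f U) :
    rectBoundaryIntegral (fun z => f z / (z - ρ) ^ (n + 1)) a b c d =
      2 * Real.pi * I * ((swap dslope ρ)^[n] f) ρ := by
  have hab : a ≤ b := (ha.trans hb).le
  have hcd : c ≤ d := (hc.trans hd).le
  have hρK : ρ ∈ Icc a b ×ℂ Icc c d := ⟨⟨ha.le, hb.le⟩, ⟨hc.le, hd.le⟩⟩
  have hUρ : U ∈ 𝓝 ρ := hU.mem_nhds (hKU hρK)
  obtain ⟨hKbot, hKtop, hKleft, hKright⟩ := mem_reProdIm_of_edge hab hcd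
  have hbot0 : ∀ x : ℝ, ((x : ℂ) + c * I) ≠ ρ := fun x => ne_of_im_ne' (by simp; exact hc.ne)
  have htop0 : ∀ x : ℝ, ((x : ℂ) + d * I) ≠ ρ := fun x => ne_of_im_ne' (by simp; exact hd.ne')
  have hleft0 : ∀ y : ℝ, ((a : ℂ) + y * I) ≠ ρ := fun y => ne_of_re_ne' (by simp; exact ha.ne)
  have hright0 : ∀ y : ℝ, ((b : ℂ) + y * I) ≠ ρ := fun y => ne_of_re_ne' (by simp; exact hb.ne')
  induction n generalizing f with
  | zero =>
    simp only [Function.iterate_zero, id_eq, zero_add, pow_one]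
    have h := integral_boundary_rect_div_sub_eq (f := f) ρ ha hb hc hd (hf.mono hKU)
    rw [rectBoundaryIntegral_def, h]
  | succ n ih =>
    have hds : DifferentiableOn ℂ (dslope f ρ) U := (Complex.differentiableOn_dslope hUρ).2 hf
    have hsplit : ∀ z : ℂ, z ≠ ρ → f z / (z - ρ) ^ (n + 1 + 1) =
        f ρ * (z - ρ) ^ (-((n : ℤ) + 2)) + dslope f ρ z / (z - ρ) ^ (n + 1) := by
      intro z hz
      have hz' : z - ρ ≠ 0 := sub_ne_zero.2 hz
      rw [eq_add_sub_mul_dslope f ρ z, zpow_neg,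
        show ((n : ℤ) + 2) = ((n + 2 : ℕ) : ℤ) by push_cast; ring, zpow_natCast]
      field_simp
      ring
    rw [rectBoundaryIntegral_congr
      (G := fun z => f ρ * (z - ρ) ^ (-((n : ℤ) + 2)) + dslope f ρ z / (z - ρ) ^ (n + 1))
      hab hcd (fun x _ => hsplit _ (hbot0 x))
      (fun x _ => hsplit _ (htop0 x)) (fun y _ => hsplit _ (hleft0 y))
      (fun y _ => hsplit _ (hright0 y))]
    -- continuity of both pieces at boundary points
    have hc1 : ∀ z : ℂ, z ≠ ρ → ContinuousAt (fun z : ℂ => f ρ * (z - ρ) ^ (-((n : ℤ) + 2))) z :=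
      fun z hz => continuousAt_const.mul ((continuousAt_id.sub continuousAt_const).zpow₀ _
        (Or.inl (sub_ne_zero.2 hz)))
    have hc2 : ∀ z : ℂ, z ∈ Icc a b ×ℂ Icc c d → z ≠ ρ →
        ContinuousAt (fun z : ℂ => dslope f ρ z / (z - ρ) ^ (n + 1)) z := by
      intro z hzK hz
      refine ContinuousAt.div ?_ ((continuousAt_id.sub continuousAt_const).pow _)
        (pow_ne_zero _ (sub_ne_zero.2 hz))
      exact (hds.differentiableAt (hU.mem_nhds (hKU hzK))).continuousAt
    rw [rectBoundaryIntegral_add hab hcd (fun x _ => hc1 _ (hbot0 x)) (fun x _ => hc1 _ (htop0 x))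
      (fun y _ => hc1 _ (hleft0 y)) (fun y _ => hc1 _ (hright0 y))
      (fun x hx => hc2 _ (hKbot x hx) (hbot0 x)) (fun x hx => hc2 _ (hKtop x hx) (htop0 x))
      (fun y hy => hc2 _ (hKleft y hy) (hleft0 y)) (fun y hy => hc2 _ (hKright y hy) (hright0 y)),
      rectBoundaryIntegral_const_mul, rectBoundaryIntegral_sub_zpow_eq_zero ρ (k := -((n : ℤ) + 2))
        (by omega) ha hb hc hd, mul_zero, zero_add, ih hds,
      Function.iterate_succ_apply]

/-- The Taylor coefficient `((swap dslope ρ)^[n] f) ρ` is `f^{(n)}(ρ)/n!` for `f` complex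
differentiable near `ρ` (uniqueness of the power series expansion:
`HasFPowerSeriesAt.has_fpower_series_iterate_dslope_fslope` and
`HasFPowerSeriesOnBall.factorial_smul`). [folklore] -/
theorem iterate_dslope_apply_eq_iteratedDeriv_div {f : ℂ → ℂ} {U : Set ℂ} {ρ : ℂ}
    (hUρ : U ∈ 𝓝 ρ) (hf : DifferentiableOn ℂ f U) (n : ℕ) :
    ((swap dslope ρ)^[n] f) ρ = iteratedDeriv n f ρ / (n.factorial : ℂ) := by
  obtain ⟨p, r, hp⟩ := hf.analyticAt hUρ
  have hpa : HasFPowerSeriesAt f p ρ := ⟨r, hp⟩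
  have h1 := (hpa.has_fpower_series_iterate_dslope_fslope n).coeff_zero 1
  rw [← h1]
  have h2 : (FormalMultilinearSeries.fslope^[n] p) 0 1 = p.coeff n := by
    rw [← FormalMultilinearSeries.coeff, FormalMultilinearSeries.coeff_iterate_fslope, zero_add]
  rw [h2]
  have h3 := hp.factorial_smul 1 n
  rw [iteratedDeriv_eq_iteratedFDeriv, ← h3, nsmul_eq_mul]
  have hn : ((n.factorial : ℕ) : ℂ) ≠ 0 := by exact_mod_cast n.factorial_ne_zero
  field_simp
  rfl

/-- **Cauchy's integral formula for derivatives on a rectangle**, derivative form: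
`∮_{∂R} f(z)/(z − ρ)^{n+1} dz = 2πi f^{(n)}(ρ)/n!`. [folklore] -/
theorem rectBoundaryIntegral_div_pow_succ_eq_iteratedDeriv {f : ℂ → ℂ} {U : Set ℂ}
    (hU : IsOpen U) (ρ : ℂ) (n : ℕ) (ha : a < ρ.re) (hb : ρ.re < b) (hc : c < ρ.im)
    (hd : ρ.im < d) (hKU : Icc a b ×ℂ Icc c d ⊆ U) (hf : DifferentiableOn ℂ f U) :
    rectBoundaryIntegral (fun z => f z / (z - ρ) ^ (n + 1)) a b c d =
      2 * Real.pi * I * (iteratedDeriv n f ρ / (n.factorial : ℂ)) := by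
  rw [rectBoundaryIntegral_div_pow_succ_eq hU ρ n ha hb hc hd hKU hf,
    iterate_dslope_apply_eq_iteratedDeriv_div (hU.mem_nhds (hKU ⟨⟨ha.le, hb.le⟩, ⟨hc.le, hd.le⟩⟩))
      hf]

/-- **Cauchy's estimate from a square.** If `f` is complex differentiable on an open set
containing the closed square of half-side `η > 0` centred at `ρ` and `‖f‖ ≤ M` on its boundary,
then the `n`-th Taylor coefficient satisfies `‖a_n‖ ≤ 2M/η^n`
(`8ηM/η^{n+1}` for the four edges, divided by `2π > 4`). [folklore] -/
theorem norm_iterate_dslope_apply_le {f : ℂ → ℂ} {U : Set ℂ} (hU : IsOpen U) (ρ : ℂ) (n : ℕ)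
    {η M : ℝ} (hη : 0 < η)
    (hKU : Icc (ρ.re - η) (ρ.re + η) ×ℂ Icc (ρ.im - η) (ρ.im + η) ⊆ U)
    (hf : DifferentiableOn ℂ f U)
    (hM : ∀ z ∈ Icc (ρ.re - η) (ρ.re + η) ×ℂ Icc (ρ.im - η) (ρ.im + η), ‖z - ρ‖ ≥ η → ‖f z‖ ≤ M) :
    ‖((swap dslope ρ)^[n] f) ρ‖ ≤ 2 * M / η ^ n := by
  have hab : ρ.re - η < ρ.re := by linarith
  have hb : ρ.re < ρ.re + η := by linarith
  have hc : ρ.im - η < ρ.im := by linarith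
  have hd : ρ.im < ρ.im + η := by linarith
  have hmain := rectBoundaryIntegral_div_pow_succ_eq hU ρ n hab hb hc hd hKU hf
  obtain ⟨hKbot, hKtop, hKleft, hKright⟩ := mem_reProdIm_of_edge (hab.trans hb).le (hc.trans hd).le
  have hM0 : 0 ≤ M := by
    have := hM _ (hKright _ (left_mem_Icc.2 (hc.trans hd).le)) (by
      refine le_trans ?_ (abs_re_le_norm _)
      simp [le_abs_self])
    exact (norm_nonneg _).trans this
  -- bound of the integrand on the boundary: `‖f z/(z-ρ)^{n+1}‖ ≤ M/η^{n+1}` when `‖z-ρ‖ ≥ η`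
  have hbound : ∀ z ∈ Icc (ρ.re - η) (ρ.re + η) ×ℂ Icc (ρ.im - η) (ρ.im + η), ‖z - ρ‖ ≥ η →
      ‖f z / (z - ρ) ^ (n + 1)‖ ≤ M / η ^ (n + 1) := by
    intro z hz hzρ
    rw [norm_div, norm_pow]
    have hpow : η ^ (n + 1) ≤ ‖z - ρ‖ ^ (n + 1) := pow_le_pow_left₀ hη.le hzρ _
    exact div_le_div₀ hM0 (hM z hz hzρ) (pow_pos hη _) hpow
  have hre : ∀ (x y : ℝ), |x - ρ.re| ≤ ‖((x : ℂ) + y * I) - ρ‖ := fun x y => by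
    have := abs_re_le_norm (((x : ℂ) + y * I) - ρ); simpa using this
  have him : ∀ (x y : ℝ), |y - ρ.im| ≤ ‖((x : ℂ) + y * I) - ρ‖ := fun x y => by
    have := abs_im_le_norm (((x : ℂ) + y * I) - ρ); simpa using this
  have e_bot : ‖∫ x : ℝ in (ρ.re - η)..(ρ.re + η), f (x + (ρ.im - η : ℝ) * I) /
      ((x : ℂ) + (ρ.im - η : ℝ) * I - ρ) ^ (n + 1)‖ ≤ M / η ^ (n + 1) * |ρ.re + η - (ρ.re - η)| :=
    intervalIntegral.norm_integral_le_of_norm_le_const fun x hx => by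
      rw [Set.uIoc_of_le (hab.trans hb).le] at hx
      refine hbound _ (hKbot x ⟨hx.1.le, hx.2⟩) ?_
      refine le_trans ?_ (him x _)
      rw [show ρ.im - η - ρ.im = -η by ring, abs_neg, abs_of_pos hη]
  have e_top : ‖∫ x : ℝ in (ρ.re - η)..(ρ.re + η), f (x + (ρ.im + η : ℝ) * I) /
      ((x : ℂ) + (ρ.im + η : ℝ) * I - ρ) ^ (n + 1)‖ ≤ M / η ^ (n + 1) * |ρ.re + η - (ρ.re - η)| :=
    intervalIntegral.norm_integral_le_of_norm_le_const fun x hx => by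
      rw [Set.uIoc_of_le (hab.trans hb).le] at hx
      refine hbound _ (hKtop x ⟨hx.1.le, hx.2⟩) ?_
      refine le_trans ?_ (him x _)
      rw [show ρ.im + η - ρ.im = η by ring, abs_of_pos hη]
  have e_left : ‖∫ y : ℝ in (ρ.im - η)..(ρ.im + η), f ((ρ.re - η : ℝ) + y * I) /
      (((ρ.re - η : ℝ) : ℂ) + y * I - ρ) ^ (n + 1)‖ ≤ M / η ^ (n + 1) * |ρ.im + η - (ρ.im - η)| :=
    intervalIntegral.norm_integral_le_of_norm_le_const fun y hy => by
      rw [Set.uIoc_of_le (hc.trans hd).le] at hy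
      refine hbound _ (hKleft y ⟨hy.1.le, hy.2⟩) ?_
      refine le_trans ?_ (hre _ y)
      rw [show ρ.re - η - ρ.re = -η by ring, abs_neg, abs_of_pos hη]
  have e_right : ‖∫ y : ℝ in (ρ.im - η)..(ρ.im + η), f ((ρ.re + η : ℝ) + y * I) /
      (((ρ.re + η : ℝ) : ℂ) + y * I - ρ) ^ (n + 1)‖ ≤ M / η ^ (n + 1) * |ρ.im + η - (ρ.im - η)| :=
    intervalIntegral.norm_integral_le_of_norm_le_const fun y hy => by
      rw [Set.uIoc_of_le (hc.trans hd).le] at hy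
      refine hbound _ (hKright y ⟨hy.1.le, hy.2⟩) ?_
      refine le_trans ?_ (hre _ y)
      rw [show ρ.re + η - ρ.re = η by ring, abs_of_pos hη]
  have hlen1 : |ρ.re + η - (ρ.re - η)| = 2 * η := by
    rw [show ρ.re + η - (ρ.re - η) = 2 * η by ring, abs_of_pos (by linarith)]
  have hlen2 : |ρ.im + η - (ρ.im - η)| = 2 * η := by
    rw [show ρ.im + η - (ρ.im - η) = 2 * η by ring, abs_of_pos (by linarith)]
  rw [hlen1] at e_bot e_top
  rw [hlen2] at e_left e_right
  -- the boundary integral is bounded by `4 · (M/η^{n+1}) · 2η = 8M/η^n`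
  have htot : ‖rectBoundaryIntegral (fun z => f z / (z - ρ) ^ (n + 1)) (ρ.re - η) (ρ.re + η)
      (ρ.im - η) (ρ.im + η)‖ ≤ 4 * (M / η ^ (n + 1) * (2 * η)) := by
    rw [rectBoundaryIntegral_def]
    have hI : ∀ w : ℂ, ‖I * w‖ = ‖w‖ := fun w => by rw [norm_mul, Complex.norm_I, one_mul]
    calc _ ≤ ‖(∫ x : ℝ in (ρ.re - η)..(ρ.re + η), f (x + (ρ.im - η : ℝ) * I) /
              ((x : ℂ) + (ρ.im - η : ℝ) * I - ρ) ^ (n + 1)) -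
            (∫ x : ℝ in (ρ.re - η)..(ρ.re + η), f (x + (ρ.im + η : ℝ) * I) /
              ((x : ℂ) + (ρ.im + η : ℝ) * I - ρ) ^ (n + 1)) +
            I * (∫ y : ℝ in (ρ.im - η)..(ρ.im + η), f ((ρ.re + η : ℝ) + y * I) /
              (((ρ.re + η : ℝ) : ℂ) + y * I - ρ) ^ (n + 1))‖ +
          ‖I * (∫ y : ℝ in (ρ.im - η)..(ρ.im + η), f ((ρ.re - η : ℝ) + y * I) /
              (((ρ.re - η : ℝ) : ℂ) + y * I - ρ) ^ (n + 1))‖ := norm_sub_le _ _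
      _ ≤ ‖(∫ x : ℝ in (ρ.re - η)..(ρ.re + η), f (x + (ρ.im - η : ℝ) * I) /
              ((x : ℂ) + (ρ.im - η : ℝ) * I - ρ) ^ (n + 1)) -
            (∫ x : ℝ in (ρ.re - η)..(ρ.re + η), f (x + (ρ.im + η : ℝ) * I) /
              ((x : ℂ) + (ρ.im + η : ℝ) * I - ρ) ^ (n + 1))‖ +
            ‖I * (∫ y : ℝ in (ρ.im - η)..(ρ.im + η), f ((ρ.re + η : ℝ) + y * I) /
              (((ρ.re + η : ℝ) : ℂ) + y * I - ρ) ^ (n + 1))‖ +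
          ‖I * (∫ y : ℝ in (ρ.im - η)..(ρ.im + η), f ((ρ.re - η : ℝ) + y * I) /
              (((ρ.re - η : ℝ) : ℂ) + y * I - ρ) ^ (n + 1))‖ :=
          add_le_add (norm_add_le _ _) le_rfl
      _ ≤ (M / η ^ (n + 1) * (2 * η) + M / η ^ (n + 1) * (2 * η)) +
            M / η ^ (n + 1) * (2 * η) + M / η ^ (n + 1) * (2 * η) := by
          rw [hI, hI]
          exact add_le_add (add_le_add ((norm_sub_le _ _).trans (add_le_add e_bot e_top)) e_right)
            e_left
      _ = 4 * (M / η ^ (n + 1) * (2 * η)) := by ring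
  rw [hmain] at htot
  have h2π : ‖(2 * Real.pi * I : ℂ)‖ = 2 * Real.pi := by
    rw [norm_mul, Complex.norm_I, mul_one, show (2 * Real.pi : ℂ) = ((2 * Real.pi : ℝ) : ℂ) by
      push_cast; ring, Complex.norm_real, Real.norm_eq_abs, abs_of_pos (by positivity)]
  rw [norm_mul, h2π] at htot
  have hpi := Real.pi_gt_three
  have hηn : 0 < η ^ n := pow_pos hη n
  rw [le_div_iff₀ hηn]
  have e : 4 * (M / η ^ (n + 1) * (2 * η)) = 8 * M / η ^ n := by
    rw [pow_succ]; field_simp; ring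
  rw [e] at htot
  have h3 : 2 * Real.pi * (‖((swap dslope ρ)^[n] f) ρ‖ * η ^ n) ≤ 8 * M := by
    have := mul_le_mul_of_nonneg_right htot hηn.le
    rwa [div_mul_cancel₀ _ hηn.ne', mul_assoc] at this
  nlinarith [norm_nonneg (((swap dslope ρ)^[n] f) ρ), hηn]

end Literature.Analysis.Complex
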